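import Summits.ResolutionOfSingularities.ResolutionOfSingularities.Theorems.EquisingularLiftEquisingularLiftNatCarrierDeltaModelFrame
import Summits.ResolutionOfSingularities.ResolutionOfSingularities.Theorems.EquisingularLiftEquisingularLiftNatCarrierDeltaOfConeForm
import Summits.ResolutionOfSingularities.ResolutionOfSingularities.Theorems.EquisingularLiftEquisingularLiftNatCarrierDeltaSectionFrameDim
import Summits.ResolutionOfSingularities.ResolutionOfSingularities.Theorems.EquisingularLiftEquisingularLiftNatDeltaConeLiftPlane
import Summits.ResolutionOfSingularities.ResolutionOfSingularities.Theorems.EquisingularLiftEquisingularLiftNatTangentConeFibreAdm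
import Summits.ResolutionOfSingularities.ResolutionOfSingularities.Theorems.EquisingularLiftEquisingularLiftNatTangentConeFibreReduced
import Summits.ResolutionOfSingularities.ResolutionOfSingularities.Theorems.EquisingularLiftEquisingularLiftNatSquarefreeInitialForm
import Summits.ResolutionOfSingularities.ResolutionOfSingularities.Theorems.EquisingularLiftEquisingularLiftNatExceptionalTracePrimes
import Summits.ResolutionOfSingularities.ResolutionOfSingularities.Theorems.EquisingularLiftEquisingularLiftNatTcDeltaPointResolutionDim
import HarnessLib

/-!
# [OURS · L1 W4.5(b) · EL♮] HΔTC (GENERAL `n`) — THE CARRIER LIFT HΔ(AdmTC) IN EVERY AMBIENT DIMENSION `n + 1` (supplier of T-INST₂ for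
# the ∀ n PARENT) and the any-n rung `stub_elnat_tcDeltaPointResolution` as a plain helper

Crux chain w45b (cell `res-hironaka`, slot W4.5(b)), working crux **EL♮** = stmt-ResolutionOfSingularities-20038 (∀ n PARENT). HONEST FRAMING:
OURS; NOT a statement of any manuscript; AI-written, weaker than expert review. No `sorry`; standard axioms. `--supports stmt-20038 --as helper`.
Assembled by res-L1-w45b-lead-1 (booked second hand, plan-1 CHAIN v7.6.2; res-type-100 first refusal asked 11:06:34Z) from res-type-100's
HΔTC₃ (`…NatCarrierDeltaHDeltaTC3`, p524961) — the SAME assembly with two bricks swapped: res-type-032's GENERAL T-ΔLIFT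
`exists_isHomogeneous_lift_deltaRegular_comp` (needs finitely many bad primes per cone chart) fed by res-L1-w45b-stub-2's T-PTPRIME-DICT
`finite_badPrimes_of_finite_nonregular_carrierTrace` (p526020) in place of the PLANE lemma; the frame dimension `n + 1` is matched against the
T-DIM antecedent instead of being pinned to `3 + 1`.

WHAT. `exists_carrierDelta_of_admTC` = the lift hypothesis **HΔ(AdmTC) with the T-DIM antecedent** of res-D-pv-029's T-INST₂
`stub_elnat_tcDeltaPointResolution_of_carrierLift_dim` (…NatTcDeltaPointResolutionDim, p521291) VERBATIM for EVERY `n`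
(`ringKrullDim 𝒪_{X',s(s₀)} = n + 1`), for every algebraically closed field `k`; hence `stub_elnat_tcDeltaPointResolution` = the REGISTERED any-n stub text
(v5.1 f6dcd08c24429701 VERBATIM, byte-compared against res-L1-w45b-lead-2's TARGET-T-ISO-0PLUS.lean; the v8 skeleton dropped its local decl, the lead
asked for the registered name 11:13:27Z), now a THEOREM: isolated hypersurface singularities in ANY dimension that are resolved downstairs by
good-point steps and fresh-carrier tangent-cone Δ-steps satisfy EL♮'s conclusion block.

PROOF = HΔTC₃'s (S1)–(S5) with (S3′): the finiteness clause «Sing(V(Z)_red) finite» of HΔ(AdmTC) is transported chart by chart to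
«finitely many primes 𝔮 ∋ ḡ_i with ḡ_i ∈ 𝔪_𝔮²» (`finite_badPrimes_of_finite_nonregular_carrierTrace`), which is the input `hfin` of
`exists_isHomogeneous_lift_deltaRegular_comp`. Credits: every brick is res-type-100 / res-type-097 / res-type-032 / res-D-pv-029 /
res-L1-w45b-stub-2 / res-L1-w45b-lead-2 by name, as in HΔTC₃.
-/

set_option linter.dupNamespace false -- mandated namespace `Summit.<Summit>.<Problem>` of this single-conjunct summit
set_option linter.overlappingInstances false -- the registered text carries `[IsDomain O] [IsDiscreteValuationRing O]`

noncomputable section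

open CategoryTheory CategoryTheory.Limits AlgebraicGeometry TopologicalSpace IsLocalRing
open Literature.AlgebraicGeometry.Resolution
open AlgebraicGeometry.Scheme.IdealSheafData

namespace Summit.ResolutionOfSingularities.ResolutionOfSingularities.Cruxes.EquisingularLiftNat.Sections

/-- **HΔTC (general `n`): the carrier lift HΔ(AdmTC) with T-DIM, ambient dimension `n + 1`** (see the module docstring).
[cite: Matsumura1987, Thm. 14.2; StacksProject, Tag 0804] -/
theorem exists_carrierDelta_of_admTC (k : Type) [Field k] [IsAlgClosed k] (n : ℕ) :
    ∀ (O : Type) [CommRing O] [IsDomain O] [IsDiscreteValuationRing O] [IsAdicComplete (IsLocalRing.maximalIdeal O) O]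
    [IsAlgClosed (IsLocalRing.ResidueField O)] (θ : O →+* k), Function.Surjective θ →
    ∀ (X' : AlgebraicGeometry.Scheme.{0}) (r' : X' ⟶ AlgebraicGeometry.Spec (.of O)) [AlgebraicGeometry.IsIntegral X']
    [IsLocallyNoetherian X'], Literature.AlgebraicGeometry.Resolution.Scheme.IsRegular X' → AlgebraicGeometry.IsProper r' →
    ∀ (U : X'.Opens), AlgebraicGeometry.Smooth (U.ι ≫ r') →
    ∀ (s : AlgebraicGeometry.Spec (.of O) ⟶ X'), s ≫ r' = 𝟙 _ → s (IsLocalRing.closedPoint O) ∈ U →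
    ringKrullDim (X'.presheaf.stalk (s (IsLocalRing.closedPoint O))) = ((n + 1 : ℕ) : WithBot ℕ∞) →
    ∀ (X₁ : AlgebraicGeometry.Scheme.{0}) (τ₁ : X₁ ⟶ X'), Literature.AlgebraicGeometry.Resolution.IsBlowup τ₁ s.ker →
    ∀ (F₁ : AlgebraicGeometry.Scheme.{0}) [AlgebraicGeometry.IsIntegral F₁] (j : F₁ ⟶ X')
    (t : F₁ ⟶ AlgebraicGeometry.Spec (.of k)),
    IsPullback j t r' (AlgebraicGeometry.Spec.map (CommRingCat.ofHom θ)) →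
    ∀ (x : F₁) (hx : IsClosed ({x} : Set F₁)), s (IsLocalRing.closedPoint O) = j x →
    ∀ (F₂ : AlgebraicGeometry.Scheme.{0}) [AlgebraicGeometry.IsIntegral F₂] (υ : F₂ ⟶ F₁),
    Literature.AlgebraicGeometry.Resolution.IsBlowup υ
    (AlgebraicGeometry.Scheme.IdealSheafData.vanishingIdeal (⟨{x}, hx⟩ : TopologicalSpace.Closeds F₁)) →
    ∀ (j₂ : F₂ ⟶ X₁) (t₂ : F₂ ⟶ AlgebraicGeometry.Spec (.of k)),
    IsPullback j₂ t₂ (τ₁ ≫ r') (AlgebraicGeometry.Spec.map (CommRingCat.ofHom θ)) → j₂ ≫ τ₁ = υ ≫ j →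
    (s.ker.comap τ₁).comap j₂ =
    (AlgebraicGeometry.Scheme.IdealSheafData.vanishingIdeal (⟨{x}, hx⟩ : TopologicalSpace.Closeds F₁)).comap υ →
    ∀ (W : Set F₁) (hZ : IsClosed (υ ⁻¹' {x} ∩ closure (υ ⁻¹' (W \ {x})))), x ∈ W →
    ¬ (υ ⁻¹' {x} ⊆ closure (υ ⁻¹' (W \ {x}))) →
    (∃ U₁ : F₁.affineOpens, x ∈ (U₁ : F₁.Opens) ∧
    ((AlgebraicGeometry.Scheme.IdealSheafData.vanishingIdeal
    (⟨closure W, isClosed_closure⟩ : TopologicalSpace.Closeds F₁)).ideal U₁).IsPrincipal) →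
    Set.Finite {z : ↥(AlgebraicGeometry.Scheme.IdealSheafData.vanishingIdeal
    (⟨υ ⁻¹' {x} ∩ closure (υ ⁻¹' (W \ {x})), hZ⟩ : TopologicalSpace.Closeds F₂)).subscheme |
    ¬ IsRegularLocalRing ((AlgebraicGeometry.Scheme.IdealSheafData.vanishingIdeal
    (⟨υ ⁻¹' {x} ∩ closure (υ ⁻¹' (W \ {x})), hZ⟩ : TopologicalSpace.Closeds F₂)).subscheme.presheaf.stalk z)} →
    ∃ C : X₁.IdealSheafData, Literature.AlgebraicGeometry.Resolution.Scheme.IsRegular C.subscheme ∧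
    AlgebraicGeometry.Flat (C.subschemeι ≫ τ₁ ≫ r') ∧
    (C.support : Set X₁) ⊆ ((s.ker.comap τ₁).support : Set X₁) ∧
    C.comap j₂ = AlgebraicGeometry.Scheme.IdealSheafData.vanishingIdeal
    (⟨υ ⁻¹' {x} ∩ closure (υ ⁻¹' (W \ {x})), hZ⟩ : TopologicalSpace.Closeds F₂) := by
  intro O _ _ _ _ _ θ hθ X' r' _ _ hregX hproper U hU s hs hsU hdim4 X₁ τ₁ hτ₁ F₁ _ j t hsq x hx hss F₂ _ υ hυ j₂ t₂ hsq₂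
    hcomm hE W hZ hxW hnot hU₁ hfin
  classical
  haveI := hproper
  haveI : IsClosedImmersion (Spec.map (CommRingCat.ofHom θ)) := IsClosedImmersion.spec_of_surjective _ hθ
  haveI : IsClosedImmersion j := MorphismProperty.IsStableUnderBaseChange.of_isPullback hsq.flip inferInstance
  haveI : IsLocallyNoetherian X₁ := by
    haveI : IsProper τ₁ := hτ₁.isProper
    exact LocallyOfFiniteType.isLocallyNoetherian τ₁
  haveI : IsLocallyNoetherian F₁ := LocallyOfFiniteType.isLocallyNoetherian j
  haveI : IsLocallyNoetherian F₂ := by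
    haveI : IsProper υ := hυ.isProper
    exact LocallyOfFiniteType.isLocallyNoetherian υ
  obtain ⟨ϖ, hϖ⟩ := IsDiscreteValuationRing.exists_irreducible O
  have hϖO : ϖ ∈ maximalIdeal O := by rw [hϖ.maximalIdeal_eq]; exact Ideal.mem_span_singleton_self ϖ
  -- (S1) the frame at `p = j x`; the T-DIM antecedent matches the frame length `n'` with `n`
  rw [hss] at hdim4
  obtain ⟨n', c, θR, hcI, hqr, hdom, hθR, h𝔪, hϖc, hdimn⟩ :=
    exists_sectionFrame_forall_dim_at O r' s hs (j x) hss (hregX (j x)) ϖ hϖ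
  have hn : n' + 1 = n + 1 := by
    have h := hdimn.symm.trans hdim4
    exact_mod_cast h
  obtain rfl : n = n' := by omega
  haveI := hdom
  -- the model frame downstairs
  have hcb𝔪 := span_stalkMap_eq_maximalIdeal_of_model θ hθ r' j t hsq x ϖ hϖO c h𝔪
  have hcbar := isQuasiRegular_stalkMap_model O k θ hθ r' j t hsq x c hqr ϖ hϖ hϖc
  haveI hFreg : IsRegularLocalRing (F₁.presheaf.stalk x) :=
    isRegularLocalRing_stalk_of_model O k θ hθ r' j t hsq x (hregX (j x)) ϖ hϖ c h𝔪 hϖc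
  have hJ : s.ker.comap j = vanishingIdeal ⟨{x}, hx⟩ :=
    comap_ker_eq_vanishingIdeal_of_model θ hθ r' s hs j t hsq x hx hss c hcI hcb𝔪
  haveI hmax : (Ideal.span (Set.range fun i => (j.stalkMap x).hom (c i))).IsMaximal := by
    rw [hcb𝔪]; exact maximalIdeal.isMaximal _
  -- (S2) T-TCONE downstairs: the initial form `Φ₁` of `closure W` at `c̄` and its square-free reduction `G`
  obtain ⟨U₁, hxU₁, hpr⟩ := hU₁
  obtain ⟨d, Φ₁, -, hΦ₁d, hΦ₁0, hW⟩ :=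
    exists_isHomogeneous_of_isPrincipal hx hυ (fun i => (j.stalkMap x).hom (c i)) hcb𝔪 W hxW U₁ hxU₁ hpr hnot
  obtain ⟨d', G, hGd', hG0, -, hR1, hR1', hR2, hR2sq⟩ :=
    exists_isHomogeneous_squarefree_reduction (fun i => (j.stalkMap x).hom (c i)) hmax Φ₁ hΦ₁d hΦ₁0
  -- (S3) the residue model `π₀ : O ↠ k₀ = 𝒪_{F₁,x}/(c̄)` and T-ΔLIFT in the plane over `k₀`
  letI : Field (F₁.presheaf.stalk x ⧸ Ideal.span (Set.range fun i => (j.stalkMap x).hom (c i))) :=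
    Ideal.Quotient.field _
  obtain ⟨π₀, hπ₀def⟩ : ∃ π₀ : O →+* F₁.presheaf.stalk x ⧸ Ideal.span (Set.range fun i => (j.stalkMap x).hom (c i)),
      π₀ = ((Ideal.Quotient.mk (Ideal.span (Set.range fun i => (j.stalkMap x).hom (c i)))).comp
        (j.stalkMap x).hom).comp ((Scheme.ΓSpecIso (.of O)).inv ≫ r'.appTop ≫ X'.presheaf.Γgerm (j x)).hom :=
    ⟨_, rfl⟩
  obtain ⟨hπ₀, hkerπ₀⟩ := residueModel_surjective_and_ker θ hθ r' j t hsq x c θR hθR hcb𝔪 hπ₀def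
  haveI : Infinite (F₁.presheaf.stalk x ⧸ Ideal.span (Set.range fun i => (j.stalkMap x).hom (c i))) := by
    haveI : Infinite (ResidueField O) := inferInstance
    exact Infinite.of_injective (β := ResidueField O)
      ((Ideal.quotEquivOfEq hkerπ₀.symm).trans (RingHom.quotientKerEquivOfSurjective hπ₀))
      ((Ideal.quotEquivOfEq hkerπ₀.symm).trans (RingHom.quotientKerEquivOfSurjective hπ₀)).injective
  have hρ₀ : (θR.toRingHom.comp (Ideal.Quotient.mk (Ideal.span (Set.range c)))).comp
      ((Scheme.ΓSpecIso (.of O)).inv ≫ r'.appTop ≫ X'.presheaf.Γgerm (j x)).hom = RingHom.id O :=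
    RingHom.ext fun b => hθR b
  -- (S3′) the finiteness clause transported to the cone charts (res-L1-w45b-stub-2 T-PTPRIME-DICT)
  have hZ' : IsClosed (υ ⁻¹' {x} ∩ closure (υ ⁻¹' (((⟨closure W, isClosed_closure⟩ : Closeds F₁) : Set F₁) \ {x}))) := by
    rw [Closeds.coe_mk, ← closure_preimage_diff_singleton_eq_of_isBlowup hx hυ W]; exact hZ
  have hcl : (⟨υ ⁻¹' {x} ∩ closure (υ ⁻¹' (W \ {x})), hZ⟩ : Closeds F₂) =
      ⟨υ ⁻¹' {x} ∩ closure (υ ⁻¹' (((⟨closure W, isClosed_closure⟩ : Closeds F₁) : Set F₁) \ {x})), hZ'⟩ :=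
    Closeds.ext (by rw [Closeds.coe_mk, Closeds.coe_mk, Closeds.coe_mk, closure_preimage_diff_singleton_eq_of_isBlowup hx hυ W])
  have hfin' := hfin
  rw [hcl] at hfin'
  have hfin032 : ∀ i : Fin n, {𝔮 : PrimeSpectrum (MvPolynomial {l : Fin n // l ≠ i}
      (F₁.presheaf.stalk x ⧸ Ideal.span (Set.range fun i => (j.stalkMap x).hom (c i)))) |
      dehomogenize i (MvPolynomial.map (Ideal.Quotient.mk (Ideal.span (Set.range fun i => (j.stalkMap x).hom (c i)))) G) ∈ 𝔮.asIdeal ∧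
      algebraMap _ (Localization.AtPrime 𝔮.asIdeal)
        (dehomogenize i (MvPolynomial.map (Ideal.Quotient.mk (Ideal.span (Set.range fun i => (j.stalkMap x).hom (c i)))) G)) ∈
        maximalIdeal (Localization.AtPrime 𝔮.asIdeal) ^ 2}.Finite := by
    intro i
    have hGj : MvPolynomial.map (Ideal.Quotient.mk (Ideal.span (Set.range fun i => (j.stalkMap x).hom (c i))))
        (dehomogenize i G) ≠ 0 := fun h => by
      have hsq := hR2sq i
      rw [h] at hsq
      exact not_squarefree_zero hsq
    have h := finite_badPrimes_of_finite_nonregular_carrierTrace hx hυ (fun i => (j.stalkMap x).hom (c i)) hcb𝔪 hcbar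
      (Ideal.Quotient.mk (Ideal.span (Set.range fun i => (j.stalkMap x).hom (c i)))) Ideal.Quotient.mk_surjective Ideal.mk_ker
      ⟨closure W, isClosed_closure⟩ Φ₁ G hΦ₁d hΦ₁0 hW hR1 hR1' hR2 hZ' hfin' i hGj
    rw [map_dehomogenize] at h
    exact h
  obtain ⟨Φ₀, hΦ₀d, hΦ₀g, h032⟩ := exists_isHomogeneous_lift_deltaRegular_comp hϖ π₀ hπ₀ hkerπ₀
    ((Scheme.ΓSpecIso (.of O)).inv ≫ r'.appTop ≫ X'.presheaf.Γgerm (j x)).hom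
    (θR.toRingHom.comp (Ideal.Quotient.mk (Ideal.span (Set.range c)))) hρ₀
    (MvPolynomial.map (Ideal.Quotient.mk (Ideal.span (Set.range fun i => (j.stalkMap x).hom (c i)))) G)
    (hGd'.map _) hfin032
  -- consequences: `Φ₀ ≢ 0 mod 𝔪_O`, `ι_* Φ₀ ≢ 0 mod (c)`, `j^♯ ι_* Φ₀ ≡ g mod (c̄)`
  have hΦ₀res : MvPolynomial.map (IsLocalRing.residue O) Φ₀ ≠ 0 := by
    intro h
    apply hG0
    rw [← hΦ₀g]
    refine map_eq_zero_of_coeff_mem_ker π₀ fun m => ?_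
    rw [hkerπ₀, ← IsLocalRing.ker_residue]
    exact coeff_mem_ker_of_map_eq_zero (IsLocalRing.residue O) h m
  have hΦ₀ne : Φ₀ ≠ 0 := by
    intro h0
    apply hG0
    rw [← hΦ₀g, h0, map_zero]
  have hΦι : MvPolynomial.map (Ideal.Quotient.mk (Ideal.span (Set.range c)))
      (MvPolynomial.map ((Scheme.ΓSpecIso (.of O)).inv ≫ r'.appTop ≫ X'.presheaf.Γgerm (j x)).hom Φ₀) ≠ 0 := by
    intro h
    apply hΦ₀ne
    have h2 := congrArg (MvPolynomial.map θR.toRingHom) h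
    rwa [MvPolynomial.map_map, MvPolynomial.map_map, hρ₀, MvPolynomial.map_id, map_zero] at h2
  have hΦbg : MvPolynomial.map (Ideal.Quotient.mk (Ideal.span (Set.range fun i => (j.stalkMap x).hom (c i))))
      (MvPolynomial.map (j.stalkMap x).hom
        (MvPolynomial.map ((Scheme.ΓSpecIso (.of O)).inv ≫ r'.appTop ≫ X'.presheaf.Γgerm (j x)).hom Φ₀)) =
      MvPolynomial.map (Ideal.Quotient.mk (Ideal.span (Set.range fun i => (j.stalkMap x).hom (c i)))) G := by
    rw [MvPolynomial.map_map, MvPolynomial.map_map, ← hπ₀def, hΦ₀g]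
  have hΦbar : MvPolynomial.map (Ideal.Quotient.mk (Ideal.span (Set.range fun i => (j.stalkMap x).hom (c i))))
      (MvPolynomial.map (j.stalkMap x).hom
        (MvPolynomial.map ((Scheme.ΓSpecIso (.of O)).inv ≫ r'.appTop ≫ X'.presheaf.Γgerm (j x)).hom Φ₀)) ≠ 0 := by
    rw [hΦbg]; exact hG0
  -- (S4) T-CARRIER-Δ one-theorem form: the Δ-centre of the O-cone `K` with `K_p = (ι_* Φ₀ (c))`
  obtain ⟨hCreg, hCflat, hCsupp, hK⟩ := carrierDelta_clauses_of_coneForm' O r' s hs (j x) hss (hregX (j x)) τ₁ hτ₁ ϖ hϖ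
    c hcI hdim4 Φ₀ hΦ₀d hΦ₀res (fun ρ hρ i => forall_ideal_quotient_span_singleton_congr
      ((map_dehomogenize_map_of_comp_eq_id _ ρ hρ i Φ₀).trans
        (map_dehomogenize_map_of_comp_eq_id _ _ hρ₀ i Φ₀).symm) (MvPolynomial.C ϖ) (h032 i))
  refine ⟨_, hCreg, hCflat, hCsupp, ?_⟩
  -- (S5) the special fibre: (v), then T-TCONE (2) for `closure W`, then `closure W ↦ W`
  have hΦιd : (MvPolynomial.map ((Scheme.ΓSpecIso (.of O)).inv ≫ r'.appTop ≫ X'.presheaf.Γgerm (j x)).hom Φ₀).IsHomogeneous d' :=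
    hΦ₀d.map _
  rw [comap_strictTransformIdeal_sup_comap_eq_of_model τ₁ s.ker _ hτ₁ j υ j₂ hcomm x hx hυ hJ c hcI hqr _ hΦιd hΦι hK
    hcbar hΦbar]
  -- T-TCONE (2) at `closure W` with `K_G := K·𝒪_{F₁}`, `G := j^♯ ι_* Φ₀`
  have hK' : stalkIdeal ((Spec.map (CommRingCat.ofHom (Ideal.Quotient.mk (Ideal.span {MvPolynomial.eval c (MvPolynomial.map
      ((Scheme.ΓSpecIso (.of O)).inv ≫ r'.appTop ≫ X'.presheaf.Γgerm (j x)).hom Φ₀)}))) ≫ X'.fromSpecStalk (j x)).ker.comap j) x =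
      Ideal.span {MvPolynomial.eval (fun i => (j.stalkMap x).hom (c i)) (MvPolynomial.map (j.stalkMap x).hom
        (MvPolynomial.map ((Scheme.ΓSpecIso (.of O)).inv ≫ r'.appTop ≫ X'.presheaf.Γgerm (j x)).hom Φ₀))} := by
    rw [stalkIdeal_comap_eq_map_stalkMap, hK, Ideal.map_span, Set.image_singleton, ringHom_eval_eq_eval_map]
  rw [hcl]
  exact (vanishingIdeal_carrierTrace_eq_strictTransformIdeal_sup_comap hx hυ (fun i => (j.stalkMap x).hom (c i)) hcb𝔪 hcbar
    ⟨closure W, isClosed_closure⟩ _ Φ₁ _ hΦ₁d (hΦιd.map _) hΦ₁0 hΦbar hW hK' (by rw [hΦbg]; exact hR1)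
    (by rw [hΦbg]; exact hR1') (fun i => by rw [map_dehomogenize, hΦbg, ← map_dehomogenize]; exact hR2 i) hZ').symm


/-- **[OURS · L1 W4.5(b)] THE ANY-`n` TANGENT-CONE-Δ RUNG `stub_elnat_tcDeltaPointResolution`, now a theorem.** The REGISTERED any-n stub text
(res-L1-w45b-lead-2 TARGET-T-ISO-0PLUS.lean / skeleton v5.1 f6dcd08c24429701, VERBATIM; = the `n = 3` closer
`stub_elnat_tcDeltaPointResolution_three` p525573 with the clause `n = 3 →` deleted): an integral hypersurface `H ⊆ ℙⁿ_k` of ANY dimension whose singularities are resolved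
downstairs by good-point steps and fresh-carrier tangent-cone Δ-steps (closure (P)/(TC) with a regular reduced end) satisfies EL♮'s conclusion
block at `H`. Proof: res-D-pv-029's T-INST₂ `stub_elnat_tcDeltaPointResolution_of_carrierLift_dim` (p521291, any `n`) fed with
`exists_carrierDelta_of_admTC k n`. [folklore] -/
theorem stub_elnat_tcDeltaPointResolution (p : ℕ) : p.Prime → ∀ (k : Type) [Field k] [CharP k p] [IsAlgClosed k] (n : ℕ) (H : AlgebraicGeometry.Scheme.{0}) (ι : H ⟶ (Literature.AlgebraicGeometry.Motives.projectiveSpace n k).left), AlgebraicGeometry.IsClosedImmersion ι → AlgebraicGeometry.IsIntegral H → (∀ y : (Literature.AlgebraicGeometry.Motives.projectiveSpace n k).left, ∃ U : (Literature.AlgebraicGeometry.Motives.projectiveSpace n k).left.affineOpens, y ∈ (U : (Literature.AlgebraicGeometry.Motives.projectiveSpace n k).left.Opens) ∧ (ι.ker.ideal U).IsPrincipal) → (∃ (F' : AlgebraicGeometry.Scheme.{0}) (ρ' : F' ⟶ (Literature.AlgebraicGeometry.Motives.projectiveSpace n k).left) (T' : Set F'), (∀ Q : (∀ F₁ : AlgebraicGeometry.Scheme.{0},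 (F₁ ⟶ (Literature.AlgebraicGeometry.Motives.projectiveSpace n k).left) → Set F₁ → Prop), Q (Literature.AlgebraicGeometry.Motives.projectiveSpace n k).left (CategoryTheory.CategoryStruct.id (Literature.AlgebraicGeometry.Motives.projectiveSpace n k).left) (Set.range ι) → (∀ (F₁ F₂ : AlgebraicGeometry.Scheme.{0}) (ρ : F₁ ⟶ (Literature.AlgebraicGeometry.Motives.projectiveSpace n k).left) (T₁ : Set F₁) (x : ↥(AlgebraicGeometry.Scheme.IdealSheafData.vanishingIdeal (⟨closure T₁, isClosed_closure⟩ : TopologicalSpace.Closeds F₁)).subscheme) (υ : F₂ ⟶ F₁) (hx : IsClosed ({((AlgebraicGeometry.Scheme.IdealSheafData.vanishingIdeal (⟨closure T₁, isClosed_closure⟩ : TopologicalSpace.Closeds F₁)).subschemeι x : F₁)} : Set F₁)), Q F₁ ρ T₁ → ¬ IsRegularLocalRing ((AlgebraicGeometry.Scheme.IdealSheafData.vanishingIdeal (⟨closure T₁, isClosed_closure⟩ : TopologicalSpace.Closeds F₁)).subscheme.presheaf.stalk x) → IsRegularLocalRing (F₁.presheaf.stalk (((AlgebraicGeometry.Scheme.IdealSheafData.vanishingIdeal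 (⟨closure T₁, isClosed_closure⟩ : TopologicalSpace.Closeds F₁))).subschemeι x : F₁)) → Literature.AlgebraicGeometry.Resolution.IsBlowup υ (AlgebraicGeometry.Scheme.IdealSheafData.vanishingIdeal (⟨{((AlgebraicGeometry.Scheme.IdealSheafData.vanishingIdeal (⟨closure T₁, isClosed_closure⟩ : TopologicalSpace.Closeds F₁)).subschemeι x : F₁)}, hx⟩ : TopologicalSpace.Closeds F₁)) → Q F₂ (CategoryTheory.CategoryStruct.comp υ ρ) (closure (υ ⁻¹' (T₁ \ {((AlgebraicGeometry.Scheme.IdealSheafData.vanishingIdeal (⟨closure T₁, isClosed_closure⟩ : TopologicalSpace.Closeds F₁)).subschemeι x : F₁)})))) → (∀ (F₁ F₂ F₃ : AlgebraicGeometry.Scheme.{0}) (ρ : F₁ ⟶ (Literature.AlgebraicGeometry.Motives.projectiveSpace n k).left) (T₁ : Set F₁) (x : ↥((AlgebraicGeometry.Scheme.IdealSheafData.vanishingIdeal (⟨closure T₁, isClosed_closure⟩ : TopologicalSpace.Closeds F₁))).subscheme) (υ : F₂ ⟶ F₁) (hx : IsClosed ({(((AlgebraicGeometry.Scheme.IdealSheafData.vanishingIdeal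 (⟨closure T₁, isClosed_closure⟩ : TopologicalSpace.Closeds F₁))).subschemeι x : F₁)} : Set F₁)) (W : Set F₁) (υ' : F₃ ⟶ F₂) (hZ : IsClosed (υ ⁻¹' {(((AlgebraicGeometry.Scheme.IdealSheafData.vanishingIdeal (⟨closure T₁, isClosed_closure⟩ : TopologicalSpace.Closeds F₁))).subschemeι x : F₁)} ∩ closure (υ ⁻¹' (W \ {(((AlgebraicGeometry.Scheme.IdealSheafData.vanishingIdeal (⟨closure T₁, isClosed_closure⟩ : TopologicalSpace.Closeds F₁))).subschemeι x : F₁)})))), Q F₁ ρ T₁ → ¬ IsRegularLocalRing (((AlgebraicGeometry.Scheme.IdealSheafData.vanishingIdeal (⟨closure T₁, isClosed_closure⟩ : TopologicalSpace.Closeds F₁))).subscheme.presheaf.stalk x) → IsRegularLocalRing (F₁.presheaf.stalk (((AlgebraicGeometry.Scheme.IdealSheafData.vanishingIdeal (⟨closure T₁, isClosed_closure⟩ : TopologicalSpace.Closeds F₁))).subschemeι x : F₁)) → Literature.AlgebraicGeometry.Resolution.IsBlowup υ (AlgebraicGeometry.Scheme.IdealSheafData.vanishingIdeal (⟨{(((AlgebraicGeometry.Scheme.IdealSheafData.vanishingIdeal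 (⟨closure T₁, isClosed_closure⟩ : TopologicalSpace.Closeds F₁))).subschemeι x : F₁)}, hx⟩ : TopologicalSpace.Closeds F₁)) → (((AlgebraicGeometry.Scheme.IdealSheafData.vanishingIdeal (⟨closure T₁, isClosed_closure⟩ : TopologicalSpace.Closeds F₁))).subschemeι x : F₁) ∈ W → ¬ (υ ⁻¹' {(((AlgebraicGeometry.Scheme.IdealSheafData.vanishingIdeal (⟨closure T₁, isClosed_closure⟩ : TopologicalSpace.Closeds F₁))).subschemeι x : F₁)} ⊆ closure (υ ⁻¹' (W \ {(((AlgebraicGeometry.Scheme.IdealSheafData.vanishingIdeal (⟨closure T₁, isClosed_closure⟩ : TopologicalSpace.Closeds F₁))).subschemeι x : F₁)}))) → (∃ U : F₁.affineOpens, (((AlgebraicGeometry.Scheme.IdealSheafData.vanishingIdeal (⟨closure T₁, isClosed_closure⟩ : TopologicalSpace.Closeds F₁))).subschemeι x : F₁) ∈ (U : F₁.Opens) ∧ ((AlgebraicGeometry.Scheme.IdealSheafData.vanishingIdeal (⟨closure W, isClosed_closure⟩ : TopologicalSpace.Closeds F₁)).ideal U).IsPrincipal) → (υ ⁻¹' {(((AlgebraicGeometry.Scheme.IdealSheafData.vanishingIdeal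 (⟨closure T₁, isClosed_closure⟩ : TopologicalSpace.Closeds F₁))).subschemeι x : F₁)} ∩ closure (υ ⁻¹' (W \ {(((AlgebraicGeometry.Scheme.IdealSheafData.vanishingIdeal (⟨closure T₁, isClosed_closure⟩ : TopologicalSpace.Closeds F₁))).subschemeι x : F₁)}))) ⊆ closure (υ ⁻¹' (T₁ \ {(((AlgebraicGeometry.Scheme.IdealSheafData.vanishingIdeal (⟨closure T₁, isClosed_closure⟩ : TopologicalSpace.Closeds F₁))).subschemeι x : F₁)})) → ¬ (closure (υ ⁻¹' (T₁ \ {(((AlgebraicGeometry.Scheme.IdealSheafData.vanishingIdeal (⟨closure T₁, isClosed_closure⟩ : TopologicalSpace.Closeds F₁))).subschemeι x : F₁)})) ⊆ (υ ⁻¹' {(((AlgebraicGeometry.Scheme.IdealSheafData.vanishingIdeal (⟨closure T₁, isClosed_closure⟩ : TopologicalSpace.Closeds F₁))).subschemeι x : F₁)} ∩ closure (υ ⁻¹' (W \ {(((AlgebraicGeometry.Scheme.IdealSheafData.vanishingIdeal (⟨closure T₁, isClosed_closure⟩ : TopologicalSpace.Closeds F₁))).subschemeι x : F₁)})))) → Set.Finite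 {z : ↥((AlgebraicGeometry.Scheme.IdealSheafData.vanishingIdeal (⟨(υ ⁻¹' {(((AlgebraicGeometry.Scheme.IdealSheafData.vanishingIdeal (⟨closure T₁, isClosed_closure⟩ : TopologicalSpace.Closeds F₁))).subschemeι x : F₁)} ∩ closure (υ ⁻¹' (W \ {(((AlgebraicGeometry.Scheme.IdealSheafData.vanishingIdeal (⟨closure T₁, isClosed_closure⟩ : TopologicalSpace.Closeds F₁))).subschemeι x : F₁)}))), hZ⟩ : TopologicalSpace.Closeds F₂))).subscheme | ¬ IsRegularLocalRing (((AlgebraicGeometry.Scheme.IdealSheafData.vanishingIdeal (⟨(υ ⁻¹' {(((AlgebraicGeometry.Scheme.IdealSheafData.vanishingIdeal (⟨closure T₁, isClosed_closure⟩ : TopologicalSpace.Closeds F₁))).subschemeι x : F₁)} ∩ closure (υ ⁻¹' (W \ {(((AlgebraicGeometry.Scheme.IdealSheafData.vanishingIdeal (⟨closure T₁, isClosed_closure⟩ : TopologicalSpace.Closeds F₁))).subschemeι x : F₁)}))), hZ⟩ : TopologicalSpace.Closeds F₂))).subscheme.presheaf.stalk z)} → Literature.AlgebraicGeometry.Resolution.IsBlowup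 υ' (AlgebraicGeometry.Scheme.IdealSheafData.vanishingIdeal (⟨(υ ⁻¹' {(((AlgebraicGeometry.Scheme.IdealSheafData.vanishingIdeal (⟨closure T₁, isClosed_closure⟩ : TopologicalSpace.Closeds F₁))).subschemeι x : F₁)} ∩ closure (υ ⁻¹' (W \ {(((AlgebraicGeometry.Scheme.IdealSheafData.vanishingIdeal (⟨closure T₁, isClosed_closure⟩ : TopologicalSpace.Closeds F₁))).subschemeι x : F₁)}))), hZ⟩ : TopologicalSpace.Closeds F₂)) → Q F₃ (CategoryTheory.CategoryStruct.comp (CategoryTheory.CategoryStruct.comp υ' υ) ρ) (closure (υ' ⁻¹' (closure (υ ⁻¹' (T₁ \ {(((AlgebraicGeometry.Scheme.IdealSheafData.vanishingIdeal (⟨closure T₁, isClosed_closure⟩ : TopologicalSpace.Closeds F₁))).subschemeι x : F₁)})) \ (υ ⁻¹' {(((AlgebraicGeometry.Scheme.IdealSheafData.vanishingIdeal (⟨closure T₁, isClosed_closure⟩ : TopologicalSpace.Closeds F₁))).subschemeι x : F₁)} ∩ closure (υ ⁻¹' (W \ {(((AlgebraicGeometry.Scheme.IdealSheafData.vanishingIdeal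 (⟨closure T₁, isClosed_closure⟩ : TopologicalSpace.Closeds F₁))).subschemeι x : F₁)}))))))) → Q F' ρ' T') ∧ Literature.AlgebraicGeometry.Resolution.Scheme.IsRegular (AlgebraicGeometry.Scheme.IdealSheafData.vanishingIdeal (⟨closure T', isClosed_closure⟩ : TopologicalSpace.Closeds F')).subscheme) → ∃ (O : Type) (_ : CommRing O) (_ : IsDomain O) (_ : IsDiscreteValuationRing O) (_ : CharZero O) (π : O →+* k), Function.Surjective π ∧ (letI := MvPolynomial.gradedAlgebra (σ := Fin (n + 1)) (R := O); letI := MvPolynomial.gradedAlgebra (σ := Fin (n + 1)) (R := k); ∀ (φ : MvPolynomial.homogeneousSubmodule (Fin (n + 1)) O →+*ᵍ MvPolynomial.homogeneousSubmodule (Fin (n + 1)) k) (hφ' : HomogeneousIdeal.irrelevant (MvPolynomial.homogeneousSubmodule (Fin (n + 1)) k) ≤ (HomogeneousIdeal.irrelevant (MvPolynomial.homogeneousSubmodule (Fin (n + 1)) O)).map φ), (∀ s, φ s = MvPolynomial.map π s) → ∀ Y : Set (AlgebraicGeometry.Proj (MvPolynomial.homogeneousSubmodule (Fin (n + 1)) O)),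 Y = Set.range (CategoryTheory.CategoryStruct.comp ι (AlgebraicGeometry.Proj.map φ hφ') : H ⟶ (AlgebraicGeometry.Proj (MvPolynomial.homogeneousSubmodule (Fin (n + 1)) O))) → ∃ (P' : AlgebraicGeometry.Scheme.{0}) (σ : P' ⟶ (AlgebraicGeometry.Proj (MvPolynomial.homogeneousSubmodule (Fin (n + 1)) O))) (S' : Set P'), (∀ Q : (∀ X' : AlgebraicGeometry.Scheme.{0}, (X' ⟶ (AlgebraicGeometry.Proj (MvPolynomial.homogeneousSubmodule (Fin (n + 1)) O))) → Set X' → Prop), Q (AlgebraicGeometry.Proj (MvPolynomial.homogeneousSubmodule (Fin (n + 1)) O)) (CategoryTheory.CategoryStruct.id (AlgebraicGeometry.Proj (MvPolynomial.homogeneousSubmodule (Fin (n + 1)) O))) Y → (∀ (X' X'' : AlgebraicGeometry.Scheme.{0}) (σ' : X' ⟶ (AlgebraicGeometry.Proj (MvPolynomial.homogeneousSubmodule (Fin (n + 1)) O))) (Y' : Set X') (C : X'.IdealSheafData) (τ : X'' ⟶ X'), Q X' σ' Y' → Literature.AlgebraicGeometry.Resolution.IsBlowup τ C → Literature.AlgebraicGeometry.Resolution.Scheme.IsRegular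 C.subscheme → AlgebraicGeometry.Flat (CategoryTheory.CategoryStruct.comp C.subschemeι (CategoryTheory.CategoryStruct.comp σ' (CategoryTheory.CategoryStruct.comp (AlgebraicGeometry.Proj.toSpecZero (MvPolynomial.homogeneousSubmodule (Fin (n + 1)) O)) (AlgebraicGeometry.Spec.map (CommRingCat.ofHom (algebraMap O (MvPolynomial.homogeneousSubmodule (Fin (n + 1)) O 0))))))) → σ' '' (C.support : Set X') ⊆ {x | ¬ IsGenericPoint x Y} → (C.support : Set X') ∩ (CategoryTheory.CategoryStruct.comp σ' (CategoryTheory.CategoryStruct.comp (AlgebraicGeometry.Proj.toSpecZero (MvPolynomial.homogeneousSubmodule (Fin (n + 1)) O)) (AlgebraicGeometry.Spec.map (CommRingCat.ofHom (algebraMap O (MvPolynomial.homogeneousSubmodule (Fin (n + 1)) O 0)))))) ⁻¹' {IsLocalRing.closedPoint O} ⊆ Y' → Q X'' (CategoryTheory.CategoryStruct.comp τ σ') (closure (τ ⁻¹' (Y' \ (C.support : Set X'))))) → Q P' σ S') ∧ Literature.AlgebraicGeometry.Resolution.Scheme.IsRegular (AlgebraicGeometry.Scheme.IdealSheafData.vanishingIdeal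 (⟨closure S', isClosed_closure⟩ : TopologicalSpace.Closeds P')).subscheme) := by
  intro hp k _ _ _ n H ι hι hH hpr hres
  exact stub_elnat_tcDeltaPointResolution_of_carrierLift_dim p hp k n H ι hι hH hpr
    (exists_carrierDelta_of_admTC k n) hres

end Summit.ResolutionOfSingularities.ResolutionOfSingularities.Cruxes.EquisingularLiftNat.Sections

end
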